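import Literature.Barriers.CriticalPhenomena.WeaklySAWTorusFeynmanKac
import HarnessLib

/-!
# The torus resolvent for a COMPLEX potential: `(-Δ_Λ + v)⁻¹ = Σ_k (D⁻¹P)^k D⁻¹` and its
# expansion over step sequences (`Re v ≥ m > 0`)

Companion to `WeaklySAWTorusFeynmanKac.lean` (the torus Laplacian `Δ_Λ`, the real resolvent
`(-Δ_Λ + v)⁻¹ = Σ_k(D⁻¹P)^kD⁻¹` for `v ≥ m > 0`, its expansion over step sequences). For the
`τ`-isomorphism behind Proposition 3.1 of Bauerschmidt–Brydges–Slade 2015 (arXiv:1403.7422) the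
potential must be allowed to be COMPLEX with positive real part — [BIS09] (Brydges–Imbrie–Slade,
Probab. Surveys 6 (2009), arXiv:0906.0922) Theorem 2.4: for a complex diagonal `D` with `D - J`
diagonally dominant, "`C = (D-J)⁻¹` exists and `G^srw_{a,b} = Σ_{ω∈𝒲_{a,b}} J^ω Π_{i=0}^{|ω|} d_{ω(i)}⁻¹
= (D-J)⁻¹_{a,b}`", proved by "`Σ_n (D⁻¹(JD⁻¹)ⁿ)_{a,b}` … `D - J` applied to the right-hand side gives
the identity", used in Proposition 4.4 with `v_x ↦ -iv_x + ε`.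

This file proves that theorem for the torus `Λ = ℤ^d/nℤ^d` (`n ≥ 1`), `J = P` the step matrix,
`d_y = 2d + v(y)` with `Re v ≥ m > 0`, by norm-domination by the real objects of the companion file:

* `torusStepMatrixC`, **`schrodingerMatrixC d n v = -Δ_Λ + v`** (`schrodingerMatrixC_eq`),
  `transferMatrixC = D⁻¹P`, `resolventTermC v k = T^kD⁻¹`, `resolventMatrixC = Σ_k T^kD⁻¹`;
* domination `‖(2d+v_y)⁻¹‖ ≤ (2d+m)⁻¹`, `norm_transferMatrixC_pow_le`, `norm_resolventTermC_le`
  (by the real `transferMatrix d n (fun _ => m)`), `summable_norm_resolventTermC`;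
* the telescoping `schrodingerMatrixC_mul_sum_resolventTermC`, `tendsto_boundaryTermC`, hence
  **`schrodingerMatrixC_inv`: `(-Δ_Λ + v)⁻¹ = Σ_k T^kD⁻¹`** (with both one-sided inverse identities);
* the walk expansion: `stepSeqSumC` with the first-step recursion `stepSeqSumC_succ` and
  `stepSeqSumC_eq_mulVec` (`S_k = T^kD⁻¹φ`), the killed weights
  `stepSeqWeightC n v b e = 𝟙{ē(k)=b}Π_{i≤k}(2d+v(ē(i)))⁻¹`, and
  **`schrodingerMatrixC_inv_apply_eq_tsum`: `(-Δ_Λ+v)⁻¹_{0,b} = Σ_k Σ_{e} w_v(e)`**, absolutely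
  convergent (`summable_sum_norm_stepSeqWeightC`, `sum_norm_stepSeqWeightC_le`).

Everything is proved; no named facts.
-/

noncomputable section

open Filter Topology Set Complex
open Literature.Probability.LatticeModels
open Literature.Probability.LatticeModels.SRW (Dir stepVec StepSeq pos endpoint card_dir)
open scoped BigOperators

namespace Literature.Barriers.CriticalPhenomena

namespace CTWSAW

variable {d n : ℕ}

/-! ### The complex Schrödinger matrix `-Δ_Λ + v` and its transfer matrix -/

section Matrices

variable (d n)

/-- The step matrix of the torus with complex entries (`P_{y,y'} = #{e : y' = y + ē}`). [folklore] -/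
def torusStepMatrixC : Matrix (TorusSite d n) (TorusSite d n) ℂ :=
  (torusStepMatrix d n).map ((↑) : ℝ → ℂ)

/-- `-Δ_Λ + v` for a complex potential `v : Λ → ℂ`, in the form `D - P`, `D = diag(2d + v)`.
[cite: BrydgesImbrieSlade2009, Theorem 2.4 (the matrix D - J with complex diagonal D)] -/
def schrodingerMatrixC (v : TorusSite d n → ℂ) : Matrix (TorusSite d n) (TorusSite d n) ℂ :=
  Matrix.diagonal (fun y => 2 * d + v y) - torusStepMatrixC d n

/-- The complex transfer matrix `T = D⁻¹P`. [folklore] -/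
def transferMatrixC (v : TorusSite d n → ℂ) : Matrix (TorusSite d n) (TorusSite d n) ℂ :=
  Matrix.of fun y y' => (2 * d + v y)⁻¹ * torusStepMatrixC d n y y'

/-- The `k`-jump term `T^k D⁻¹` of the complex resolvent series. [folklore] -/
def resolventTermC [NeZero n] (v : TorusSite d n → ℂ) (k : ℕ) :
    Matrix (TorusSite d n) (TorusSite d n) ℂ :=
  transferMatrixC d n v ^ k * Matrix.diagonal fun y => (2 * d + v y)⁻¹

/-- The complex resolvent series `R = Σ_k T^k D⁻¹`, entrywise. [folklore] -/
def resolventMatrixC [NeZero n] (v : TorusSite d n → ℂ) : Matrix (TorusSite d n) (TorusSite d n) ℂ :=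
  Matrix.of fun y y' => ∑' k, resolventTermC d n v k y y'

variable {d n}

/-- Entries of the complex step matrix. [folklore] -/
@[simp] theorem torusStepMatrixC_apply (y y' : TorusSite d n) :
    torusStepMatrixC d n y y' = (torusStepMatrix d n y y' : ℂ) := rfl

/-- Entries of the complex transfer matrix. [folklore] -/
theorem transferMatrixC_apply (v : TorusSite d n → ℂ) (y y' : TorusSite d n) :
    transferMatrixC d n v y y' = (2 * d + v y)⁻¹ * (torusStepMatrix d n y y' : ℂ) := rfl

/-- The complex Schrödinger matrix is `-Δ_Λ + diag v` (the real Laplacian read in `ℂ`). [cite: BauerschmidtBrydgesSlade2015LogCorr, §4.1 (C = (-Δ+m²)⁻¹)] -/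
theorem schrodingerMatrixC_eq (v : TorusSite d n → ℂ) :
    schrodingerMatrixC d n v = -(torusLaplacian d n).map ((↑) : ℝ → ℂ) + Matrix.diagonal v := by
  ext y y'
  simp only [schrodingerMatrixC, torusLaplacian, torusStepMatrixC, Matrix.sub_apply, Matrix.add_apply,
    Matrix.neg_apply, Matrix.map_apply, Matrix.diagonal_apply]
  split_ifs <;> push_cast <;> ring

/-! ### Norm domination by the real transfer matrix with the constant potential `m` -/

variable {v : TorusSite d n → ℂ} {m : ℝ}

/-- `|2d + v(y)| ≥ 2d + Re v(y) ≥ 2d + m`, so `‖(2d + v(y))⁻¹‖ ≤ (2d+m)⁻¹`. [cite: BrydgesImbrieSlade2009, Theorem 2.5/2.6 (hypothesis d̄_x < d_x + Re v_x)] -/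
theorem norm_inv_two_d_add_le (hm : 0 < 2 * d + m) (hv : ∀ y, m ≤ (v y).re) (y : TorusSite d n) :
    ‖(2 * d + v y)⁻¹‖ ≤ (2 * d + m)⁻¹ := by
  have h1 : 2 * d + m ≤ ‖(2 * (d : ℂ) + v y)‖ := by
    refine le_trans ?_ (Complex.re_le_norm _)
    simp only [Complex.add_re, Complex.re_ofNat, Complex.mul_re, Complex.natCast_re,
      Complex.im_ofNat, Complex.natCast_im, mul_zero, sub_zero]
    linarith [hv y]
  have hpos : 0 < ‖(2 * (d : ℂ) + v y)‖ := lt_of_lt_of_le hm h1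
  rw [norm_inv]
  exact inv_anti₀ hm h1

/-- `2d + v(y) ≠ 0` under `Re v ≥ m > -2d`. [folklore] -/
theorem two_d_add_ne_zero (hm : 0 < 2 * d + m) (hv : ∀ y, m ≤ (v y).re) (y : TorusSite d n) :
    (2 * d + v y : ℂ) ≠ 0 := by
  intro h
  have := norm_inv_two_d_add_le hm hv y
  have h2 : 2 * d + m ≤ ‖(2 * (d : ℂ) + v y)‖ := by
    refine le_trans ?_ (Complex.re_le_norm _)
    simp only [Complex.add_re, Complex.re_ofNat, Complex.mul_re, Complex.natCast_re,
      Complex.im_ofNat, Complex.natCast_im, mul_zero, sub_zero]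
    linarith [hv y]
  rw [h, norm_zero] at h2
  linarith

/-- Entrywise domination `‖T_{y,y'}‖ ≤ T^{(m)}_{y,y'}` by the real transfer matrix of the constant
potential `m`. [folklore] -/
theorem norm_transferMatrixC_le (hm : 0 < 2 * d + m) (hv : ∀ y, m ≤ (v y).re) (y y' : TorusSite d n) :
    ‖transferMatrixC d n v y y'‖ ≤ transferMatrix d n (fun _ => m) y y' := by
  rw [transferMatrixC_apply, transferMatrix_apply, norm_mul, Complex.norm_real,
    Real.norm_of_nonneg (torusStepMatrix_nonneg y y')]
  exact mul_le_mul_of_nonneg_right (norm_inv_two_d_add_le hm hv y) (torusStepMatrix_nonneg y y')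

variable [NeZero n]

/-- Powers are dominated entrywise: `‖(T^k)_{y,y'}‖ ≤ (T^{(m)k})_{y,y'}`. [folklore] -/
theorem norm_transferMatrixC_pow_le (hm : 0 < 2 * d + m) (hv : ∀ y, m ≤ (v y).re) (k : ℕ)
    (y y' : TorusSite d n) :
    ‖(transferMatrixC d n v ^ k) y y'‖ ≤ (transferMatrix d n (fun _ => m) ^ k) y y' := by
  have hv' : ∀ y : TorusSite d n, 0 < 2 * d + (fun _ => m) y := fun _ => hm
  induction k generalizing y y' with
  | zero =>
    rw [pow_zero, pow_zero, Matrix.one_apply, Matrix.one_apply]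
    split_ifs <;> simp
  | succ k ih =>
    rw [pow_succ, pow_succ, Matrix.mul_apply, Matrix.mul_apply]
    refine (norm_sum_le _ _).trans (Finset.sum_le_sum fun z _ => ?_)
    rw [norm_mul]
    exact mul_le_mul (ih y z) (norm_transferMatrixC_le hm hv z y') (norm_nonneg _)
      (transferMatrix_pow_nonneg hv' k y z)

/-- Entries of the `k`-jump term. [folklore] -/
theorem resolventTermC_apply (v : TorusSite d n → ℂ) (k : ℕ) (y y' : TorusSite d n) :
    resolventTermC d n v k y y' = (transferMatrixC d n v ^ k) y y' * (2 * d + v y')⁻¹ := by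
  rw [resolventTermC, Matrix.mul_diagonal]

/-- Domination of the `k`-jump terms by the real ones: `‖(T^kD⁻¹)_{yy'}‖ ≤ (T^{(m)k}D_m⁻¹)_{yy'}`.
[folklore] -/
theorem norm_resolventTermC_le (hm : 0 < 2 * d + m) (hv : ∀ y, m ≤ (v y).re) (k : ℕ)
    (y y' : TorusSite d n) :
    ‖resolventTermC d n v k y y'‖ ≤ resolventTerm (fun _ => m) k y y' := by
  rw [resolventTermC_apply, resolventTerm_apply, norm_mul]
  have hv' : ∀ y : TorusSite d n, 0 < 2 * d + (fun _ => m) y := fun _ => hm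
  exact mul_le_mul (norm_transferMatrixC_pow_le hm hv k y y') (norm_inv_two_d_add_le hm hv y')
    (norm_nonneg _) (transferMatrix_pow_nonneg hv' k y y')

/-- The complex resolvent series converges absolutely (`Re v ≥ m > 0`). [folklore] -/
theorem summable_norm_resolventTermC (hm : 0 < m) (hv : ∀ y, m ≤ (v y).re) (y y' : TorusSite d n) :
    Summable fun k => ‖resolventTermC d n v k y y'‖ := by
  have hm' : 0 < 2 * d + m := by positivity
  have hvr : ∀ y : TorusSite d n, 0 < 2 * d + (fun _ => m) y := fun _ => hm'
  refine Summable.of_nonneg_of_le (fun k => norm_nonneg _) (fun k => norm_resolventTermC_le hm' hv k y y')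
    (summable_resolventTerm hm (fun _ => le_rfl) y y')

/-- The complex resolvent series converges. [folklore] -/
theorem summable_resolventTermC (hm : 0 < m) (hv : ∀ y, m ≤ (v y).re) (y y' : TorusSite d n) :
    Summable fun k => resolventTermC d n v k y y' :=
  (summable_norm_resolventTermC hm hv y y').of_norm

/-- Entries of the resolvent. [folklore] -/
theorem resolventMatrixC_apply (v : TorusSite d n → ℂ) (y y' : TorusSite d n) :
    resolventMatrixC d n v y y' = ∑' k, resolventTermC d n v k y y' := rfl

/-! ### Telescoping and the inverse -/

/-- `D T = P`. [folklore] -/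
theorem diagonal_mul_transferMatrixC (hm : 0 < 2 * d + m) (hv : ∀ y, m ≤ (v y).re) :
    Matrix.diagonal (fun y => 2 * (d : ℂ) + v y) * transferMatrixC d n v = torusStepMatrixC d n := by
  ext y y'
  rw [Matrix.diagonal_mul, transferMatrixC_apply, ← mul_assoc,
    mul_inv_cancel₀ (two_d_add_ne_zero hm hv y), one_mul, torusStepMatrixC_apply]

/-- `D D⁻¹ = 1`. [folklore] -/
theorem diagonal_mul_diagonal_inv (hm : 0 < 2 * d + m) (hv : ∀ y, m ≤ (v y).re) :
    Matrix.diagonal (fun y => 2 * (d : ℂ) + v y) * Matrix.diagonal (fun y => (2 * (d : ℂ) + v y)⁻¹) = 1 := by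
  rw [Matrix.diagonal_mul_diagonal, ← Matrix.diagonal_one]
  congr 1; funext y; exact mul_inv_cancel₀ (two_d_add_ne_zero hm hv y)

/-- **Telescoping**: `(-Δ_Λ + v) Σ_{k<K} T^kD⁻¹ = 1 - DT^KD⁻¹`. [cite: BrydgesImbrieSlade2009, Theorem 2.4 (proof: "D - J applied to the right-hand side gives the identity")] -/
theorem schrodingerMatrixC_mul_sum_resolventTermC (hm : 0 < 2 * d + m) (hv : ∀ y, m ≤ (v y).re) (K : ℕ) :
    schrodingerMatrixC d n v * ∑ k ∈ Finset.range K, resolventTermC d n v k =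
      1 - Matrix.diagonal (fun y => 2 * (d : ℂ) + v y) * transferMatrixC d n v ^ K *
        Matrix.diagonal fun y => (2 * (d : ℂ) + v y)⁻¹ := by
  have h1 : schrodingerMatrixC d n v =
      Matrix.diagonal (fun y => 2 * (d : ℂ) + v y) * (1 - transferMatrixC d n v) := by
    rw [schrodingerMatrixC, mul_sub, mul_one, diagonal_mul_transferMatrixC hm hv]
  simp only [resolventTermC]
  rw [← Finset.sum_mul, h1, mul_assoc, ← mul_assoc (1 - transferMatrixC d n v), mul_neg_geom_sum,
    sub_mul, one_mul, mul_sub, diagonal_mul_diagonal_inv hm hv, mul_assoc]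

/-- The partial sums converge entrywise to the resolvent. [folklore] -/
theorem tendsto_sum_resolventTermC (hm : 0 < m) (hv : ∀ y, m ≤ (v y).re) (y y' : TorusSite d n) :
    Tendsto (fun K => (∑ k ∈ Finset.range K, resolventTermC d n v k) y y') atTop
      (𝓝 (resolventMatrixC d n v y y')) := by
  simp only [Matrix.sum_apply, resolventMatrixC_apply]
  exact (summable_resolventTermC hm hv y y').hasSum.tendsto_sum_nat

/-- The boundary term `DT^KD⁻¹ → 0` entrywise. [folklore] -/
theorem tendsto_boundaryTermC (hm : 0 < m) (hv : ∀ y, m ≤ (v y).re) (y y' : TorusSite d n) :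
    Tendsto (fun K => (Matrix.diagonal (fun y => 2 * (d : ℂ) + v y) * transferMatrixC d n v ^ K *
      Matrix.diagonal (fun y => (2 * (d : ℂ) + v y)⁻¹)) y y') atTop (𝓝 0) := by
  have hm' : 0 < 2 * d + m := by positivity
  have heq : ∀ K, (Matrix.diagonal (fun y => 2 * (d : ℂ) + v y) * transferMatrixC d n v ^ K *
      Matrix.diagonal (fun y => (2 * (d : ℂ) + v y)⁻¹)) y y' =
        (2 * d + v y) * (transferMatrixC d n v ^ K) y y' * (2 * d + v y')⁻¹ := fun K => by
    rw [Matrix.mul_diagonal, Matrix.diagonal_mul]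
  simp_rw [heq]
  have hgeom := tendsto_pow_atTop_nhds_zero_of_lt_one (by positivity : (0:ℝ) ≤ 2 * d / (2 * d + m))
    (ratio_lt_one hm)
  have h0 : Tendsto (fun K => (transferMatrixC d n v ^ K) y y') atTop (𝓝 0) := by
    refine squeeze_zero_norm (fun K => (norm_transferMatrixC_pow_le hm' hv K y y').trans
      (transferMatrix_pow_le hm' (fun _ => le_rfl) K y y')) hgeom
  simpa using (h0.const_mul (2 * (d : ℂ) + v y)).mul_const (2 * (d : ℂ) + v y')⁻¹

/-- **`(-Δ_Λ + v) R = 1`** (`Re v ≥ m > 0`). [cite: BrydgesImbrieSlade2009, Theorem 2.4] -/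
theorem schrodingerMatrixC_mul_resolventMatrixC (hm : 0 < m) (hv : ∀ y, m ≤ (v y).re) :
    schrodingerMatrixC d n v * resolventMatrixC d n v = 1 := by
  have hm' : 0 < 2 * d + m := by positivity
  ext y y'
  have h1 : Tendsto (fun K => (schrodingerMatrixC d n v * ∑ k ∈ Finset.range K, resolventTermC d n v k) y y')
      atTop (𝓝 ((schrodingerMatrixC d n v * resolventMatrixC d n v) y y')) := by
    simp only [Matrix.mul_apply]
    exact tendsto_finsetSum _ fun z _ => (tendsto_sum_resolventTermC hm hv z y').const_mul _
  have h2 : Tendsto (fun K => (schrodingerMatrixC d n v * ∑ k ∈ Finset.range K, resolventTermC d n v k) y y')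
      atTop (𝓝 ((1 : Matrix (TorusSite d n) (TorusSite d n) ℂ) y y')) := by
    simp_rw [schrodingerMatrixC_mul_sum_resolventTermC hm' hv]
    simp only [Matrix.sub_apply]
    simpa using (tendsto_const_nhds (x := (1 : Matrix (TorusSite d n) (TorusSite d n) ℂ) y y')).sub
      (tendsto_boundaryTermC hm hv y y')
  exact tendsto_nhds_unique h1 h2

/-- **[BIS09, Theorem 2.4]: `(-Δ_Λ + v)⁻¹ = Σ_k (D⁻¹P)^kD⁻¹`** for a complex potential with
`Re v ≥ m > 0` (diagonal dominance `Σ_{y'}|P_{yy'}/d_y| = 2d/|2d+v_y| < 1`).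
[cite: BrydgesImbrieSlade2009, Theorem 2.4] -/
theorem schrodingerMatrixC_inv (hm : 0 < m) (hv : ∀ y, m ≤ (v y).re) :
    (schrodingerMatrixC d n v)⁻¹ = resolventMatrixC d n v :=
  Matrix.inv_eq_right_inv (schrodingerMatrixC_mul_resolventMatrixC hm hv)

/-- `(-Δ_Λ + v)` is invertible: `R(-Δ_Λ+v) = 1` as well. [cite: BrydgesImbrieSlade2009, Theorem 2.4 ("C = (D-J)⁻¹ exists")] -/
theorem resolventMatrixC_mul_schrodingerMatrixC (hm : 0 < m) (hv : ∀ y, m ≤ (v y).re) :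
    resolventMatrixC d n v * schrodingerMatrixC d n v = 1 :=
  mul_eq_one_comm.1 (schrodingerMatrixC_mul_resolventMatrixC hm hv)

end Matrices

/-! ### Expansion over step sequences -/

section StepSeqs

variable [NeZero n] {v : TorusSite d n → ℂ} {m : ℝ}

/-- The `k`-jump layer from `y` with a complex endpoint weight `φ`:
`S_k(y) = Σ_{e : k steps} φ(y + ē(k)) Π_{i≤k}(2d + v(y + ē(i)))⁻¹`. [cite: BrydgesImbrieSlade2009, eq. (Gsrw) (G^srw = Σ_ω J^ω Π d_{ω(i)}⁻¹)] -/
def stepSeqSumC (n : ℕ) (v φ : TorusSite d n → ℂ) (k : ℕ) (y : TorusSite d n) : ℂ :=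
  ∑ e : StepSeq d k, φ (y + Torus.proj n (endpoint e)) *
    ∏ i ∈ Finset.range (k + 1), (2 * d + v (y + Torus.proj n (pos e i)))⁻¹

omit [NeZero n] in
/-- No jumps: `S_0(y) = φ(y)/(2d + v(y))`. [folklore] -/
theorem stepSeqSumC_zero (v φ : TorusSite d n → ℂ) (y : TorusSite d n) :
    stepSeqSumC n v φ 0 y = (2 * d + v y)⁻¹ * φ y := by
  simp [stepSeqSumC, mul_comm]

omit [NeZero n] in
/-- **First-step analysis**: `S_{k+1}(y) = (2d + v(y))⁻¹ Σ_{|a|=1} S_k(y + ā)`. [cite: BrydgesImbrieSlade2009, Theorem 2.4 (proof, eq. (Gsrw2))] -/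
theorem stepSeqSumC_succ (v φ : TorusSite d n → ℂ) (k : ℕ) (y : TorusSite d n) :
    stepSeqSumC n v φ (k + 1) y = (2 * d + v y)⁻¹ * ∑ a : Dir d, stepSeqSumC n v φ k (y + torusStep n a) := by
  unfold stepSeqSumC
  rw [Finset.mul_sum]
  rw [← Fintype.sum_equiv (Fin.consEquiv fun _ : Fin (k + 1) => Dir d)
    (fun p : Dir d × (Fin k → Dir d) => φ (y + Torus.proj n (endpoint (Fin.cons p.1 p.2 : StepSeq d (k + 1)))) *
      ∏ i ∈ Finset.range (k + 1 + 1), (2 * d + v (y + Torus.proj n (pos (Fin.cons p.1 p.2 : StepSeq d (k + 1)) i)))⁻¹)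
    _ (fun p => rfl)]
  rw [Fintype.sum_prod_type]
  refine Finset.sum_congr rfl fun a _ => ?_
  rw [Finset.mul_sum]
  refine Finset.sum_congr rfl fun e _ => ?_
  rw [Finset.prod_range_succ' _ (k + 1)]
  simp only [torusProj_pos_cons_zero, add_zero, torusProj_endpoint_cons, torusProj_pos_cons_succ]
  simp only [← add_assoc]
  ring

/-- `(Pf)(y) = Σ_a f(y + ā)` in `ℂ`. [folklore] -/
theorem torusStepMatrixC_mulVec (f : TorusSite d n → ℂ) (y : TorusSite d n) :
    (torusStepMatrixC d n).mulVec f y = ∑ a : Dir d, f (y + torusStep n a) := by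
  simp only [Matrix.mulVec, dotProduct, torusStepMatrixC_apply, torusStepMatrix_apply]
  push_cast
  simp only [Finset.sum_mul]
  rw [Finset.sum_comm]
  refine Finset.sum_congr rfl fun e _ => ?_
  simp only [apply_ite ((↑) : ℝ → ℂ), Complex.ofReal_one, Complex.ofReal_zero, ite_mul, one_mul,
    zero_mul]
  rw [Finset.sum_ite_eq' Finset.univ (y + torusStep n e)]
  simp

/-- `(Tf)(y) = (2d + v(y))⁻¹ Σ_a f(y + ā)`. [folklore] -/
theorem transferMatrixC_mulVec (v f : TorusSite d n → ℂ) (y : TorusSite d n) :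
    (transferMatrixC d n v).mulVec f y = (2 * d + v y)⁻¹ * ∑ a : Dir d, f (y + torusStep n a) := by
  rw [← torusStepMatrixC_mulVec f y]
  simp only [Matrix.mulVec, dotProduct, transferMatrixC_apply, torusStepMatrixC_apply, Finset.mul_sum,
    mul_assoc]

/-- **`S_k = T^kD⁻¹φ`**. [cite: BrydgesImbrieSlade2009, Theorem 2.4 (proof, eq. (Gsrw2): Σ_ω = Σ_n (D⁻¹(JD⁻¹)ⁿ))] -/
theorem stepSeqSumC_eq_mulVec (v φ : TorusSite d n → ℂ) :
    ∀ k : ℕ, stepSeqSumC n v φ k = (resolventTermC d n v k).mulVec φ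
  | 0 => by
    funext y
    rw [stepSeqSumC_zero, resolventTermC, pow_zero, one_mul, Matrix.mulVec_diagonal]
  | k + 1 => by
    funext y
    rw [stepSeqSumC_succ, resolventTermC, pow_succ', mul_assoc, ← Matrix.mulVec_mulVec,
      transferMatrixC_mulVec]
    congr 1
    refine Finset.sum_congr rfl fun a _ => ?_
    rw [stepSeqSumC_eq_mulVec v φ k]
    rfl

/-- With the indicator weight at `b`, started from `0`: `S_k(0) = (T^kD⁻¹)_{0,b}`. [folklore] -/
theorem stepSeqSumC_indicator (v : TorusSite d n → ℂ) (k : ℕ) (b : TorusSite d n) :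
    stepSeqSumC n v (fun y => if y = b then 1 else 0) k 0 = resolventTermC d n v k 0 b := by
  classical
  rw [stepSeqSumC_eq_mulVec]
  have h : (fun y : TorusSite d n => if y = b then (1 : ℂ) else 0) = Pi.single b 1 := by
    funext y; by_cases hy : y = b
    · subst hy; simp
    · simp [hy]
  rw [h, Matrix.mulVec_single_one]
  rfl

/-- The complex weight of a `k`-step sequence `e` from `0`, killed unless it ends in the class `b`:
`𝟙{ē(k) = b} Π_{i≤k} (2d + v(ē(i)))⁻¹`. [cite: BrydgesImbrieSlade2009, eq. (Gsrw) (J^ω Π_{i=0}^{|ω|} d_{ω(i)}⁻¹)] -/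
def stepSeqWeightC (n : ℕ) (v : TorusSite d n → ℂ) (b : TorusSite d n) {k : ℕ} (e : StepSeq d k) : ℂ :=
  (if Torus.proj n (endpoint e) = b then 1 else 0) *
    ∏ i ∈ Finset.range (k + 1), (2 * d + v (Torus.proj n (pos e i)))⁻¹

omit [NeZero n] in
/-- The `k`-step weights sum to `S_k(0)`. [folklore] -/
theorem sum_stepSeqWeightC (v : TorusSite d n → ℂ) (b : TorusSite d n) (k : ℕ) :
    ∑ e : StepSeq d k, stepSeqWeightC n v b e = stepSeqSumC n v (fun y => if y = b then 1 else 0) k 0 := by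
  simp only [stepSeqWeightC, stepSeqSumC, zero_add]

omit [NeZero n] in
/-- Norm domination of the step-sequence weights by the real weights of the constant potential `m`:
`‖w_v(e)‖ ≤ w_m(e)`. [folklore] -/
theorem norm_stepSeqWeightC_le (hm : 0 < 2 * d + m) (hv : ∀ y, m ≤ (v y).re) (b : TorusSite d n)
    {k : ℕ} (e : StepSeq d k) :
    ‖stepSeqWeightC n v b e‖ ≤ (if Torus.proj n (endpoint e) = b then (1 : ℝ) else 0) *
      ∏ i ∈ Finset.range (k + 1), (2 * d + (fun _ => m) (Torus.proj n (pos e i)))⁻¹ := by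
  rw [stepSeqWeightC, norm_mul, norm_prod]
  refine mul_le_mul ?_ (Finset.prod_le_prod (fun i _ => norm_nonneg _)
    fun i _ => norm_inv_two_d_add_le hm hv _) (Finset.prod_nonneg fun _ _ => norm_nonneg _) ?_
  · split_ifs <;> simp
  · split_ifs <;> norm_num

/-- **[BIS09, Theorem 2.4] entrywise: the resolvent as an absolutely convergent sum over walks**,
`(-Δ_Λ + v)⁻¹_{0,b} = Σ_k Σ_{e : k steps, ē(k) = b} Π_{i≤k}(2d + v(ē(i)))⁻¹` (`Re v ≥ m > 0`).
[cite: BrydgesImbrieSlade2009, Theorem 2.4, eq. (Gsrw)–(Gsrw2)] -/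
theorem schrodingerMatrixC_inv_apply_eq_tsum (hm : 0 < m) (hv : ∀ y, m ≤ (v y).re) (b : TorusSite d n) :
    (schrodingerMatrixC d n v)⁻¹ 0 b = ∑' k, ∑ e : StepSeq d k, stepSeqWeightC n v b e := by
  rw [schrodingerMatrixC_inv hm hv, resolventMatrixC_apply]
  exact tsum_congr fun k => by rw [sum_stepSeqWeightC, stepSeqSumC_indicator]

/-- The layers of the walk expansion are dominated by the real resolvent terms of the constant
potential: `Σ_e ‖w_v(e)‖ ≤ (T^{(m)k}D_m⁻¹)_{0,b}`. [folklore] -/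
theorem sum_norm_stepSeqWeightC_le (hm : 0 < 2 * d + m) (hv : ∀ y, m ≤ (v y).re) (b : TorusSite d n)
    (k : ℕ) : ∑ e : StepSeq d k, ‖stepSeqWeightC n v b e‖ ≤ resolventTerm (fun _ => m) k 0 b := by
  rw [← stepSeqSum_indicator (fun _ => m) k b, stepSeqSum]
  simp only [zero_add]
  exact Finset.sum_le_sum fun e _ => norm_stepSeqWeightC_le hm hv b e

/-- **Absolute convergence of the walk expansion**: `Σ_k Σ_e ‖w_v(e)‖ < ∞` (`Re v ≥ m > 0`).
[cite: BrydgesImbrieSlade2009, Theorem 2.4 ("the assumption that D - J is diagonally dominant ensures that the sum converges absolutely")] -/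
theorem summable_sum_norm_stepSeqWeightC (hm : 0 < m) (hv : ∀ y, m ≤ (v y).re) (b : TorusSite d n) :
    Summable fun k => ∑ e : StepSeq d k, ‖stepSeqWeightC n v b e‖ := by
  have hm' : 0 < 2 * d + m := by positivity
  have hvr : ∀ y : TorusSite d n, 0 < 2 * d + (fun _ => m) y := fun _ => hm'
  refine Summable.of_nonneg_of_le (fun k => Finset.sum_nonneg fun _ _ => norm_nonneg _)
    (fun k => sum_norm_stepSeqWeightC_le hm' hv b k) ?_
  exact summable_resolventTerm hm (fun _ => le_rfl) 0 b

end StepSeqs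

end CTWSAW

end Literature.Barriers.CriticalPhenomena
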